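import Summits.Ventures.Crystal3D.Theorems.StickyWulffConstantNoReconstructionGainSymmetry
import Summits.Ventures.Crystal3D.Theorems.StickyWulffConstantNoReconstructionGainCapLocal
import Literature.Algebra.EuclideanLattices.FccBccLattices
import HarnessLib

/-!
# Bond vectors of a moved Barlow stacking in fcc frames (bricks for the rung `barlowGrainFilm_slab`)

HONEST FRAMING. Part of the venture `Summits/Ventures/Crystal3D` (cell `crystal3d-full`), helper
`--supports` the crux `NoReconstructionGain` (stmt-Ventures-19144, route
`route-Ventures-StickyWulffConstant`), line `adhesion` (wulff-p1 g13).  Pure lattice geometry used by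
`…NoReconstructionGainBarlowGrainFilm` to instantiate the multi-frame rung `multiFrameGrainFilm_slab`
(`…MultiFrameFilm`, g12) for misoriented grains of an ARBITRARY Barlow stacking (any Hägg word):

* `basalMirror_eq`, `basalMirror_apply_*`, `inner_basalMirror_left` — the basal mirror
  `M = ((ℝ ∙ e₃)ᗮ).reflection`, `x₃ ↦ −x₃`, in coordinates;
* `fcc_unit_height` — a unit vector of `Λ₀ = fccStacking 1 √(2/3)` has height `0` or `±√(2/3)`;
* `inner_basalMirror_fcc_unit_le` — a MIRRORED out-of-plane bond of `Λ₀` (a twin bond) is at least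
  `30°` away from every bond of `Λ₀`: `⟪M v, d⟫ ≤ 5/6 ≤ √3/2` (integrality of `2⟪Λ₀, Λ₀⟫` + the height
  gap; no case table);
* `inner_pos_of_basal_tilt` — a unit vector of height `√(2/3)` (an up bond) has positive inner product
  with every unit `n` with `n₂ > 1/√3`: inside the BASAL CONE (stacking axis within `54.7°` of the cut
  normal) up bonds point `ν`-upward;
* `barlowPos_sub_eq_fcc`, `barlowPos_succ_sub_of_pos`, `basalMirror_barlowPos_succ_sub_of_neg`,
  `barlowPos_pred_sub_of_pos`, `basalMirror_barlowPos_pred_sub_of_neg` — the bond vectors of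
  `barlowStacking 1 √(2/3) σ` by the Hägg letter of the bilayer: in-layer bonds are in-plane bonds of
  `Λ₀`; bonds across an fcc-type bilayer (`σ = 1`) are out-of-plane bonds of `Λ₀`; bonds across a
  twin-type bilayer (`σ = −1`) are their basal mirror images.

WHAT THIS IS NOT: anything about packings — bookkeeping of one moved lattice frame per bilayer; rung
F-C1 not moved.
-/

noncomputable section

namespace Summit.Ventures.Crystal3D.Theorems

open Summit.Ventures.Crystal3D Finset
open Literature.MathematicalPhysics.StatisticalMechanics (fccStacking barlowStacking barlowPos constHagg
  haggLabel IsHaggSeq contactDeficiency barlowPos_apply_zero barlowPos_apply_one barlowPos_apply_two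
  haggLabel_const haggLabel_succ dist_barlowPos_eq_iff isHaggSeq_const mem_barlowStacking_iff)
open Literature.Algebra.EuclideanLattices (inner_fin_three norm_sq_fin_three)
open scoped InnerProductSpace

/-! ### Coordinates -/

/-- The axis `e₃` is a unit vector. -/
theorem bgf_norm_e3 : ‖(EuclideanSpace.single (2 : Fin 3) (1 : ℝ))‖ = 1 := by
  simp

/-- `⟪e₃, p⟫ = p₂`. -/
theorem bgf_inner_e3_left (p : EuclideanSpace ℝ (Fin 3)) :
    ⟪EuclideanSpace.single (2 : Fin 3) (1 : ℝ), p⟫_ℝ = p 2 := by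
  rw [EuclideanSpace.inner_single_left]; simp

/-! ### The basal mirror `M = ((ℝ ∙ e₃)ᗮ).reflection`, `x₃ ↦ −x₃` -/

/-- The basal mirror as a formula: `M p = p − 2 p₂ e₃`. -/
theorem basalMirror_eq (p : EuclideanSpace ℝ (Fin 3)) :
    (ℝ ∙ (EuclideanSpace.single (2 : Fin 3) (1 : ℝ)))ᗮ.reflection p =
      p - (2 * p 2) • EuclideanSpace.single (2 : Fin 3) (1 : ℝ) := by
  rw [bondReflection_apply _ _ bgf_norm_e3, bgf_inner_e3_left]

/-- Coordinates of the basal mirror: `(M p)₀ = p₀`. -/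
theorem basalMirror_apply_zero (p : EuclideanSpace ℝ (Fin 3)) :
    ((ℝ ∙ (EuclideanSpace.single (2 : Fin 3) (1 : ℝ)))ᗮ.reflection p) 0 = p 0 := by
  rw [basalMirror_eq]; simp

/-- Coordinates of the basal mirror: `(M p)₁ = p₁`. -/
theorem basalMirror_apply_one (p : EuclideanSpace ℝ (Fin 3)) :
    ((ℝ ∙ (EuclideanSpace.single (2 : Fin 3) (1 : ℝ)))ᗮ.reflection p) 1 = p 1 := by
  rw [basalMirror_eq]; simp

/-- Coordinates of the basal mirror: `(M p)₂ = −p₂`. -/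
theorem basalMirror_apply_two (p : EuclideanSpace ℝ (Fin 3)) :
    ((ℝ ∙ (EuclideanSpace.single (2 : Fin 3) (1 : ℝ)))ᗮ.reflection p) 2 = -p 2 := by
  rw [basalMirror_eq]; simp; ring

/-- `⟪M v, d⟫ = ⟪v, d⟫ − 2 v₂ d₂`. -/
theorem inner_basalMirror_left (v d : EuclideanSpace ℝ (Fin 3)) :
    ⟪(ℝ ∙ (EuclideanSpace.single (2 : Fin 3) (1 : ℝ)))ᗮ.reflection v, d⟫_ℝ = ⟪v, d⟫_ℝ - 2 * v 2 * d 2 := by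
  rw [basalMirror_eq, inner_sub_left, inner_smul_left, bgf_inner_e3_left]; simp

/-! ### Heights of unit vectors of `Λ₀` -/

/-- A unit vector of `Λ₀` has height `k √(2/3)` with `k ∈ {−1, 0, 1}`. -/
theorem fcc_unit_height {v : EuclideanSpace ℝ (Fin 3)} (hv : v ∈ fccStacking 1 (Real.sqrt (2 / 3)))
    (hv1 : ‖v‖ = 1) : ∃ k : ℤ, (k = -1 ∨ k = 0 ∨ k = 1) ∧ v 2 = k * Real.sqrt (2 / 3) := by
  obtain ⟨k, i, j, rfl⟩ := mem_barlowStacking_iff.1 hv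
  refine ⟨k, ?_, by rw [barlowPos_apply_two]⟩
  have hh : Real.sqrt (2 / 3) ^ 2 = 2 / 3 := Real.sq_sqrt (by norm_num)
  have hsq := norm_sq_fin_three (barlowPos 1 (Real.sqrt (2 / 3)) constHagg k i j)
  rw [hv1, barlowPos_apply_two] at hsq
  have hk2 : (k : ℝ) ^ 2 * (2 / 3) ≤ 1 := by
    rw [← hh]; nlinarith [sq_nonneg (barlowPos 1 (Real.sqrt (2 / 3)) constHagg k i j 0),
      sq_nonneg (barlowPos 1 (Real.sqrt (2 / 3)) constHagg k i j 1)]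
  have hk : (k : ℝ) ^ 2 ≤ 3 / 2 := by linarith
  have hkZ : k ^ 2 ≤ 1 := by
    have : (k : ℝ) ^ 2 < 2 := by linarith
    have h2 : k ^ 2 < 2 := by exact_mod_cast this
    omega
  have hk1 : -1 ≤ k ∧ k ≤ 1 := by constructor <;> nlinarith
  omega

/-- **A mirrored out-of-plane bond of `Λ₀` is at least `30°` away from every bond of `Λ₀`:**
for unit `v, d ∈ Λ₀` with `v₂ ≠ 0`, `⟪M v, d⟫ ≤ √3/2` (indeed `≤ 5/6`). -/
theorem inner_basalMirror_fcc_unit_le {v d : EuclideanSpace ℝ (Fin 3)}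
    (hv : v ∈ fccStacking 1 (Real.sqrt (2 / 3))) (hd : d ∈ fccStacking 1 (Real.sqrt (2 / 3)))
    (hv1 : ‖v‖ = 1) (hd1 : ‖d‖ = 1) (hv2 : v 2 ≠ 0) :
    ⟪(ℝ ∙ (EuclideanSpace.single (2 : Fin 3) (1 : ℝ)))ᗮ.reflection v, d⟫_ℝ ≤ Real.sqrt 3 / 2 := by
  have hh : Real.sqrt (2 / 3) ^ 2 = 2 / 3 := Real.sq_sqrt (by norm_num)
  have h3 : (5 / 3 : ℝ) ≤ Real.sqrt 3 := by
    rw [show (5 / 3 : ℝ) = Real.sqrt ((5 / 3) ^ 2) by rw [Real.sqrt_sq (by norm_num)]]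
    exact Real.sqrt_le_sqrt (by norm_num)
  rw [inner_basalMirror_left]
  obtain ⟨kv, hkv, hv2'⟩ := fcc_unit_height hv hv1
  obtain ⟨kd, hkd, hd2'⟩ := fcc_unit_height hd hd1
  have hvd1 : ⟪v, d⟫_ℝ ≤ 1 := by
    have := real_inner_le_norm v d; rw [hv1, hd1, one_mul] at this; exact this
  have hkv0 : kv ≠ 0 := by
    rintro rfl; rw [hv2'] at hv2; simp at hv2
  rcases hkd with rfl | rfl | rfl
  · -- `d` down
    rcases hkv with rfl | rfl | rfl
    · -- same height: `⟪v,d⟫ − 4/3`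
      rw [hv2', hd2']; push_cast; nlinarith
    · exact absurd rfl hkv0
    · -- opposite heights: `⟪v,d⟫ ≤ −1/2` by integrality
      obtain ⟨n, hn⟩ := exists_int_two_inner_fcc hv hd
      have hsub : (v - d) 2 ^ 2 ≤ ‖v - d‖ ^ 2 := by
        rw [norm_sq_fin_three]; nlinarith [sq_nonneg ((v - d) 0), sq_nonneg ((v - d) 1)]
      have hvd2 : (v - d) 2 = 2 * Real.sqrt (2 / 3) := by
        rw [PiLp.sub_apply, hv2', hd2']; push_cast; ring
      have hnsq : ‖v - d‖ ^ 2 = 2 - 2 * ⟪v, d⟫_ℝ := by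
        rw [norm_sub_sq_real, hv1, hd1]; ring
      rw [hvd2, hnsq] at hsub
      have hle : ⟪v, d⟫_ℝ ≤ -1 / 3 := by nlinarith
      have hn1 : n ≤ -1 := by
        have : (n : ℝ) < 0 := by rw [← hn]; linarith
        have : n < 0 := by exact_mod_cast this
        omega
      have : (n : ℝ) ≤ -1 := by exact_mod_cast hn1
      rw [hv2', hd2']; push_cast; nlinarith
  · -- `d` in plane: `⟪M v, d⟫ = ⟪v, d⟫ ≤ 1/2`
    have hne : v ≠ d := by
      rintro rfl; rw [hd2'] at hv2; simp at hv2
    have := real_inner_le_half_of_fcc_unit hv hd hv1 hd1 hne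
    rw [hd2']; push_cast; nlinarith
  · -- `d` up
    rcases hkv with rfl | rfl | rfl
    · obtain ⟨n, hn⟩ := exists_int_two_inner_fcc hv hd
      have hsub : (v - d) 2 ^ 2 ≤ ‖v - d‖ ^ 2 := by
        rw [norm_sq_fin_three]; nlinarith [sq_nonneg ((v - d) 0), sq_nonneg ((v - d) 1)]
      have hvd2 : (v - d) 2 = -(2 * Real.sqrt (2 / 3)) := by
        rw [PiLp.sub_apply, hv2', hd2']; push_cast; ring
      have hnsq : ‖v - d‖ ^ 2 = 2 - 2 * ⟪v, d⟫_ℝ := by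
        rw [norm_sub_sq_real, hv1, hd1]; ring
      rw [hvd2, hnsq] at hsub
      have hle : ⟪v, d⟫_ℝ ≤ -1 / 3 := by nlinarith
      have hn1 : n ≤ -1 := by
        have : (n : ℝ) < 0 := by rw [← hn]; linarith
        have : n < 0 := by exact_mod_cast this
        omega
      have : (n : ℝ) ≤ -1 := by exact_mod_cast hn1
      rw [hv2', hd2']; push_cast; nlinarith
    · exact absurd rfl hkv0
    · rw [hv2', hd2']; push_cast; nlinarith

/-! ### Up bonds are `ν`-upward inside the basal cone -/

/-- **Basal cone.**  A unit vector `b` of height `b₂ = √(2/3)` (an up bond of a Barlow stacking) has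
`⟪b, n⟫ > 0` for every unit `n` with `n₂ > 1/√3` (stacking axis within `54.7°` of `n`). -/
theorem inner_pos_of_basal_tilt {b n : EuclideanSpace ℝ (Fin 3)} (hb1 : ‖b‖ = 1)
    (hb2 : b 2 = Real.sqrt (2 / 3)) (hn1 : ‖n‖ = 1) (hn2 : 1 / Real.sqrt 3 < n 2) : 0 < ⟪b, n⟫_ℝ := by
  have hh : Real.sqrt (2 / 3) ^ 2 = 2 / 3 := Real.sq_sqrt (by norm_num)
  have h3 : Real.sqrt 3 ^ 2 = 3 := Real.sq_sqrt (by norm_num)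
  have h3pos : 0 < Real.sqrt 3 := Real.sqrt_pos.2 (by norm_num)
  have hinv : (1 / Real.sqrt 3) ^ 2 = 1 / 3 := by rw [div_pow, one_pow, h3]
  have hn2pos : 0 < n 2 := lt_trans (by positivity) hn2
  have hn2sq : 1 / 3 < n 2 ^ 2 := by
    rw [← hinv]; exact pow_lt_pow_left₀ hn2 (by positivity) two_ne_zero
  have hbsq := norm_sq_fin_three b
  have hnsq := norm_sq_fin_three n
  rw [hb1] at hbsq; rw [hn1] at hnsq
  have hbh : b 0 ^ 2 + b 1 ^ 2 = 1 / 3 := by rw [hb2] at hbsq; linarith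
  have hnh : n 0 ^ 2 + n 1 ^ 2 = 1 - n 2 ^ 2 := by linarith
  -- Cauchy–Schwarz on the horizontal parts
  have hcs : (b 0 * n 0 + b 1 * n 1) ^ 2 ≤ (b 0 ^ 2 + b 1 ^ 2) * (n 0 ^ 2 + n 1 ^ 2) := by
    nlinarith [sq_nonneg (b 0 * n 1 - b 1 * n 0)]
  rw [hbh, hnh] at hcs
  have hT : 0 < b 2 * n 2 := by rw [hb2]; positivity
  have hT2 : (b 2 * n 2) ^ 2 = 2 / 3 * n 2 ^ 2 := by rw [mul_pow, hb2, hh]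
  have hST : (b 0 * n 0 + b 1 * n 1) ^ 2 < (b 2 * n 2) ^ 2 := by rw [hT2]; nlinarith
  have habs : |b 0 * n 0 + b 1 * n 1| < b 2 * n 2 := abs_lt_of_sq_lt_sq hST hT.le
  rw [inner_fin_three]
  have := neg_abs_le (b 0 * n 0 + b 1 * n 1)
  linarith

/-! ### Bond vectors of a Barlow stacking, by the Hägg letter of the bilayer -/

/-- In-layer bonds of any Barlow stacking are in-plane bonds of `Λ₀`. -/
theorem barlowPos_sub_eq_fcc (σ : ℤ → ℤ) (k i j i' j' : ℤ) :
    barlowPos 1 (Real.sqrt (2 / 3)) σ k i' j' - barlowPos 1 (Real.sqrt (2 / 3)) σ k i j =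
      barlowPos 1 (Real.sqrt (2 / 3)) constHagg 0 (i' - i) (j' - j) := by
  ext l
  fin_cases l <;> simp [barlowPos_apply_zero, barlowPos_apply_one, barlowPos_apply_two] <;>
    ring

/-- Up bonds across an fcc-type bilayer (`σ k = 1`) are up bonds of `Λ₀`. -/
theorem barlowPos_succ_sub_of_pos {σ : ℤ → ℤ} {k : ℤ} (hk : σ k = 1) (i j i' j' : ℤ) :
    barlowPos 1 (Real.sqrt (2 / 3)) σ (k + 1) i' j' - barlowPos 1 (Real.sqrt (2 / 3)) σ k i j =
      barlowPos 1 (Real.sqrt (2 / 3)) constHagg 1 (i' - i) (j' - j) := by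
  have hL : haggLabel σ (k + 1) = haggLabel σ k + 1 := by rw [haggLabel_succ, hk]
  ext l
  fin_cases l <;> simp [barlowPos_apply_zero, barlowPos_apply_one, barlowPos_apply_two, haggLabel_const, hL] <;>
    ring

/-- Up bonds across a twin-type bilayer (`σ k = −1`) are mirror images of down bonds of `Λ₀`. -/
theorem basalMirror_barlowPos_succ_sub_of_neg {σ : ℤ → ℤ} {k : ℤ} (hk : σ k = -1) (i j i' j' : ℤ) :
    (ℝ ∙ (EuclideanSpace.single (2 : Fin 3) (1 : ℝ)))ᗮ.reflection
        (barlowPos 1 (Real.sqrt (2 / 3)) σ (k + 1) i' j' - barlowPos 1 (Real.sqrt (2 / 3)) σ k i j) =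
      barlowPos 1 (Real.sqrt (2 / 3)) constHagg (-1) (i' - i) (j' - j) := by
  have hL : haggLabel σ (k + 1) = haggLabel σ k - 1 := by rw [haggLabel_succ, hk]; ring
  ext l
  fin_cases l
  · simp [basalMirror_apply_zero, barlowPos_apply_zero, haggLabel_const, hL]
    ring
  · simp [basalMirror_apply_one, barlowPos_apply_one, haggLabel_const, hL]
    ring
  · simp [basalMirror_apply_two, barlowPos_apply_two]
    ring

/-- Down bonds across an fcc-type bilayer (`σ (k−1) = 1`) are down bonds of `Λ₀`. -/
theorem barlowPos_pred_sub_of_pos {σ : ℤ → ℤ} {k : ℤ} (hk : σ (k - 1) = 1) (i j i' j' : ℤ) :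
    barlowPos 1 (Real.sqrt (2 / 3)) σ (k - 1) i' j' - barlowPos 1 (Real.sqrt (2 / 3)) σ k i j =
      barlowPos 1 (Real.sqrt (2 / 3)) constHagg (-1) (i' - i) (j' - j) := by
  have hL : haggLabel σ (k - 1) = haggLabel σ k - 1 := by
    have := haggLabel_succ σ (k - 1); rw [sub_add_cancel, hk] at this; linarith
  ext l
  fin_cases l <;> simp [barlowPos_apply_zero, barlowPos_apply_one, barlowPos_apply_two, haggLabel_const, hL] <;>
    ring

/-- Down bonds across a twin-type bilayer (`σ (k−1) = −1`) are mirror images of up bonds of `Λ₀`. -/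
theorem basalMirror_barlowPos_pred_sub_of_neg {σ : ℤ → ℤ} {k : ℤ} (hk : σ (k - 1) = -1) (i j i' j' : ℤ) :
    (ℝ ∙ (EuclideanSpace.single (2 : Fin 3) (1 : ℝ)))ᗮ.reflection
        (barlowPos 1 (Real.sqrt (2 / 3)) σ (k - 1) i' j' - barlowPos 1 (Real.sqrt (2 / 3)) σ k i j) =
      barlowPos 1 (Real.sqrt (2 / 3)) constHagg 1 (i' - i) (j' - j) := by
  have hL : haggLabel σ (k - 1) = haggLabel σ k + 1 := by
    have := haggLabel_succ σ (k - 1); rw [sub_add_cancel, hk] at this; linarith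
  ext l
  fin_cases l
  · simp [basalMirror_apply_zero, barlowPos_apply_zero, haggLabel_const, hL]
    ring
  · simp [basalMirror_apply_one, barlowPos_apply_one, haggLabel_const, hL]
    ring
  · simp [basalMirror_apply_two, barlowPos_apply_two]
    ring

/-- The height of an up bond is `√(2/3)`. -/
theorem barlowPos_succ_sub_apply_two (σ : ℤ → ℤ) (k i j i' j' : ℤ) :
    (barlowPos 1 (Real.sqrt (2 / 3)) σ (k + 1) i' j' - barlowPos 1 (Real.sqrt (2 / 3)) σ k i j) 2 =
      Real.sqrt (2 / 3) := by
  simp [barlowPos_apply_two]; ring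

/-- In-plane vectors are fixed by the basal mirror. -/
theorem basalMirror_of_apply_two_eq_zero {v : EuclideanSpace ℝ (Fin 3)} (hv : v 2 = 0) :
    (ℝ ∙ (EuclideanSpace.single (2 : Fin 3) (1 : ℝ)))ᗮ.reflection v = v := by
  rw [basalMirror_eq, hv]; simp

end Summit.Ventures.Crystal3D.Theorems

end
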